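import Mathlib
import Summits.ValiantsHypothesis.ValiantsHypothesis.Theses.NewtonUnitEquations
import Summits.ValiantsHypothesis.ValiantsHypothesis.Theorems.NewtonFramesTwoProductsFrameRungTwoFaceCount
import Summits.ValiantsHypothesis.ValiantsHypothesis.Theorems.NewtonFramesTwoProductsFrameRungTwoClassHull
import Summits.ValiantsHypothesis.ValiantsHypothesis.Theorems.NewtonUnitEquationsDissociatedFixedK
import Summits.ValiantsHypothesis.ValiantsHypothesis.Theorems.TwoProducts.Negative.FirstOrderExposure

/-!
# Line `FrameRungTwo` — the next rung above the proved floor `DissociatedFixedK` (forward generator G1)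

Crux dir: `TwoProducts` (stmt-ValiantsHypothesis-5906), route `NewtonUnitEquations` (+ `NewtonFrames`).

FLOOR (seed g1-ValiantsHypothesis-5907, `Summit.ValiantsHypothesis.Theorems.dissociatedFixedK_proof`):
`NewtonUnitEquations.DissociatedFixedK` — for FIXED `k`, a sum of `k` products of `m` polynomials all drawn
from ONE common dissociated frame `A` (`supp f i j ⊆ A j`, `#A j ≤ t`, sum map injective on `Π_j A j`)
has `≤ (m t + 2)^{C(k)}` Newton vertices (`C = 2k+3`; lever = annihilating product functional on a
two-letter sub-cube, "thickness `< k`").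

THE ONE MOVE (hypothesis generalised): ONE common dissociated frame ↦ TWO dissociated frames `A 0, A 1`,
each product living on one of them (`c : Fin k → Fin 2`).  Inside a frame nothing collides; ACROSS the
two frames exponent sums may coincide and coefficients may cancel.  Graded family `FrameRung s`
(`s` frames); `FrameRung 1` is the floor (`frameRung_one`, no sorry), `FrameRungTwo := FrameRung 2` is
the rung, `∀ s, FrameRung s` = "every product on its own direct frame".  The Statement
(`ValiantsHypothesis`, via `NewtonTauRoot`/`NewtonTauWeak`) needs in addition INTERNAL coincidences
(route NewtonFrames: `ProductMinusPoints`, `ShallowChains`) and uniformity in `k` (`DissociatedUniform`),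
so no member of this family is the summit; the on-path reading is `frameRungTwoWeak_of_newtonTauWeak`.

At `k = 2` the rung is exactly one rung above the crux dir's landed UR rung (`stub_engineUniqueWords`,
p137509: word map injective on the COMMON frame `supp u_i ∪ supp v_i`): here `Π supp u_i` and `Π supp v_i`
are separately injective and cross sums `Σ u-letters = Σ v-letters` are allowed.

WHERE THE FLOOR'S PROOF STOPS: `stub_exposedWord` (one-frame dictionary vertices ↔ surviving words) and
`stub_thicknessFit` (Theorems/NewtonUnitEquationsDissociatedFixedKThickness.lean:207) need the coefficient
tensor restricted to the demotion cube of the vertex word to be `c·δ_a`; with a second frame a cube word can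
instead be cancelled by a word of the OTHER frame.  If the other frame represents the cube CARRY-FREE
(coordinate-disjoint demotion sets) the pulled-back tensor is again a sum of `≤ k` product terms on the cube
and `DissociatedFixedK.thickness_of_annihilator` applies verbatim (thickness `< k`); the open core is the
count of cross-cancelling vertices whose cube CARRIES between the two direct systems (`stub_crossCancelCount`).

Skeleton: `stub_classHull` (floor transported to each frame class; provable) →
`stub_faceCount` (planar convex geometry: cross-free vertices sit on faces of the union hull; provable) →
`stub_crossCancelCount` (OPEN core) → `FrameRungTwo_of` (proved below).

FORWARD: generator=rung ; seed=g1-ValiantsHypothesis-5907 ; witness=`frameRung_one` (this file) and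
`Lines/FrameRungTwo_special.lean` (`example : FrameRung 1`, rc 0, no sorry) ; rung_of=DissociatedFixedK ;
rung_decl=`Summit.ValiantsHypothesis.ValiantsHypothesis.Cruxes.TwoProducts.FrameRungTwo.FrameRungTwo` ;
step=hypothesis: one common dissociated frame ↦ two dissociated frames (products assigned by `c : Fin k → Fin 2`) ;
probes (planner folder `bc/FrameRungTwo_probe.lean`, all FAIL as required): `FrameRungTwo → ValiantsHypothesis`,
`→ NewtonTauWeak`, `→ TwoProducts`, `→ NewtonTauRoot`; converse `ValiantsHypothesis → FrameRungTwo`,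
`NewtonTauWeak → FrameRungTwo` (budget `(mt+2)^C` vs `2^{am}`) ; real step `DissociatedFixedK → FrameRungTwo` and
`exact?` with the floor in scope FAIL ; stubs `Stubᵢ → FrameRungTwo / → ValiantsHypothesis` FAIL (6/6) ;
gap_after: `FrameRung s` for all `s` (= per-product direct frames), then internal coincidences (NewtonFrames
`ProductMinusPoints`/`ShallowChains`, `TwoProducts`), then `k`-uniformity (`DissociatedUniform`, `NewtonTauRoot`) ;
method_family = exposed-word dictionary on a direct frame + annihilating product functional (cube lemma,
tensor-rank thickness) + Hamming-ball enumeration ; ceiling: capped in the `k`-direction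
(`Theorems/DissociatedFixedK/Negative/UniformCFalse.lean`, `…/Negative/CubeLemma.lean` sharpness; KPTT
arXiv:1308.2286 Ex. 3), no catalogued cap in the frame-count direction.
-/

set_option linter.dupNamespace false

namespace Summit.ValiantsHypothesis.ValiantsHypothesis.Cruxes.TwoProducts.FrameRungTwo

open MvPolynomial
open scoped BigOperators
open Summit.ValiantsHypothesis.ValiantsHypothesis.Theses.NewtonUnitEquations

noncomputable section

/-- The route's embedding of exponent vectors into the real plane. -/
abbrev emb : (Fin 2 →₀ ℕ) → (Fin 2 → ℝ) := fun e i => ((e i : ℕ) : ℝ)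

/-- The graded family: `k` products (fixed `k`, constant `C = C(k)`) of `m` bivariate polynomials, product
`i` drawn from the dissociated frame `A (c i)` among `s` frames; conclusion = the floor's `(m t + 2)^C`. -/
def FrameRung (s : ℕ) : Prop :=
  ∀ k : ℕ, ∃ C : ℕ, ∀ (m t : ℕ) (A : Fin s → Fin m → Finset (Fin 2 →₀ ℕ)) (c : Fin k → Fin s)
    (f : Fin k → Fin m → MvPolynomial (Fin 2) ℂ),
    (∀ σ j, (A σ j).card ≤ t) →
    (∀ i j, (f i j).support ⊆ A (c i) j) →
    (∀ σ, ∀ a b : Fin m → (Fin 2 →₀ ℕ), (∀ j, a j ∈ A σ j) → (∀ j, b j ∈ A σ j) →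
        ∑ j, a j = ∑ j, b j → a = b) →
    (Set.extremePoints ℝ (convexHull ℝ (emb '' ((∑ i, ∏ j, f i j).support : Set (Fin 2 →₀ ℕ))))).ncard
      ≤ (m * t + 2) ^ C

/-- **The rung** (crux of this line): two dissociated frames. -/
def FrameRungTwo : Prop := FrameRung 2

/-! ## The floor is `FrameRung 1`; the rung implies the floor -/

/-- WITNESS (BC5 / F3): the proved floor is literally the one-frame member of the family. -/
theorem frameRung_one : FrameRung 1 := by
  intro k
  obtain ⟨C, hC⟩ := Summit.ValiantsHypothesis.Theorems.dissociatedFixedK_proof k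
  refine ⟨C, fun m t A c f hA hf hinj => ?_⟩
  refine hC m t (A 0) f (hA 0) (fun i j => ?_) (hinj 0)
  have h := hf i j
  rwa [Subsingleton.elim (c i) 0] at h

/-- The rung is at least the floor (put every product on frame `0`). -/
theorem dissociatedFixedK_of_frameRungTwo (h : FrameRungTwo) : DissociatedFixedK := by
  intro k
  obtain ⟨C, hC⟩ := h k
  refine ⟨C, fun m t A f hA hf hinj => ?_⟩
  exact hC m t (fun _ => A) (fun _ => 0) f (fun _ j => hA j) (fun i j => hf i j) (fun _ => hinj)

/-! ## On-path reading (weak budget): a consequence of the route's target `NewtonTauWeak` -/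

/-- The rung with the route's weak budget `2^{a m} (k t + 2)^b` (per `k`). -/
def FrameRungTwoWeak : Prop :=
  ∀ k : ℕ, ∃ a b : ℕ, ∀ (m t : ℕ) (A : Fin 2 → Fin m → Finset (Fin 2 →₀ ℕ)) (c : Fin k → Fin 2)
    (f : Fin k → Fin m → MvPolynomial (Fin 2) ℂ),
    (∀ σ j, (A σ j).card ≤ t) →
    (∀ i j, (f i j).support ⊆ A (c i) j) →
    (∀ σ, ∀ a b : Fin m → (Fin 2 →₀ ℕ), (∀ j, a j ∈ A σ j) → (∀ j, b j ∈ A σ j) →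
        ∑ j, a j = ∑ j, b j → a = b) →
    (Set.extremePoints ℝ (convexHull ℝ (emb '' ((∑ i, ∏ j, f i j).support : Set (Fin 2 →₀ ℕ))))).ncard
      ≤ 2 ^ (a * m) * (k * t + 2) ^ b

/-- `NewtonTauWeak → FrameRungTwoWeak` (the weak-budget rung is ON PATH: a consequence of the route target). -/
theorem frameRungTwoWeak_of_newtonTauWeak (h : NewtonTauWeak) : FrameRungTwoWeak := by
  obtain ⟨a, b, hab⟩ := h
  intro k
  refine ⟨a, b, fun m t A c f hA hf _ => ?_⟩
  refine hab k m t f (fun i j => ?_)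
  exact (Finset.card_le_card (hf i j)).trans (hA (c i) j)

/-- `FrameRungTwo → FrameRungTwoWeak`: the rung (floor budget) sits above the on-path weak-budget statement
(`(m t + 2)^C ≤ 2^{C m} (k t + 2)^C` for `k ≥ 1`; `k = 0` is an empty sum). -/
theorem frameRungTwoWeak_of_frameRungTwo (h : FrameRungTwo) : FrameRungTwoWeak := by
  intro k
  obtain ⟨C, hC⟩ := h k
  refine ⟨C, C, fun m t A c f hA hf hinj => ?_⟩
  rcases Nat.eq_zero_or_pos k with hk | hk
  · subst hk
    have h0 : (∑ i : Fin 0, ∏ j, f i j) = 0 := by simp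
    rw [h0, MvPolynomial.support_zero, Finset.coe_empty, Set.image_empty, convexHull_empty]
    simp
  · have h1 : m * t ≤ 2 ^ m * t := Nat.mul_le_mul_right t (Nat.lt_two_pow_self).le
    have h2 : 2 ^ m * t ≤ 2 ^ m * (k * t) := Nat.mul_le_mul_left _ (Nat.le_mul_of_pos_left t hk)
    have h3 : 1 ≤ 2 ^ m := Nat.one_le_two_pow
    have key : m * t + 2 ≤ 2 ^ m * (k * t + 2) := by
      calc m * t + 2 ≤ 2 ^ m * (k * t) + 2 ^ m * 2 := by omega
        _ = 2 ^ m * (k * t + 2) := by ring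
    calc _ ≤ (m * t + 2) ^ C := hC m t A c f hA hf hinj
      _ ≤ (2 ^ m * (k * t + 2)) ^ C := Nat.pow_le_pow_left key C
      _ = 2 ^ (C * m) * (k * t + 2) ^ C := by rw [mul_pow, ← pow_mul, mul_comm m C]

/-! ## The skeleton -/

/-- STUB 1 (provable; the floor transported).  Each frame class `σ` separately is an instance of the floor:
the partial sum over the products drawn from frame `σ` has `≤ (m t + 2)^{C₁(k)}` vertices (zero out the other
class, or re-index it by `Fin k_σ`, and apply `dissociatedFixedK_proof`). [ours: dissociatedFixedK_proof] -/
theorem stub_classHull : ∀ k : ℕ, ∃ C : ℕ, ∀ (m t : ℕ) (A : Fin 2 → Fin m → Finset (Fin 2 →₀ ℕ))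
    (c : Fin k → Fin 2) (f : Fin k → Fin m → MvPolynomial (Fin 2) ℂ),
    (∀ σ j, (A σ j).card ≤ t) →
    (∀ i j, (f i j).support ⊆ A (c i) j) →
    (∀ σ, ∀ a b : Fin m → (Fin 2 →₀ ℕ), (∀ j, a j ∈ A σ j) → (∀ j, b j ∈ A σ j) →
        ∑ j, a j = ∑ j, b j → a = b) →
    ∀ σ : Fin 2, (Set.extremePoints ℝ (convexHull ℝ (emb ''
        ((∑ i ∈ Finset.univ.filter (fun i => c i = σ), ∏ j, f i j).support : Set (Fin 2 →₀ ℕ))))).ncard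
      ≤ (m * t + 2) ^ C := by
  -- LANDED (`…FrameRungTwoClassHull`, `…FrameRungTwoClassHull.stub_classHull`, statement unfolded verbatim): by-name citation (stub-credit wiring val-port-1 g1, val-lit RULING #251 (b))
  exact Summit.ValiantsHypothesis.ValiantsHypothesis.Theorems.NewtonFramesTwoProducts.FrameRungTwoClassHull.stub_classHull
/-- STUB 2 (provable; planar convex geometry).  CROSS-FREE vertices sit on the top face of the union hull:
if `p` is a vertex of `conv X`, strictly exposed in `X` by `l`, and NO point of `Y₀ ∪ Y₁ ⊇ X` lies strictly
above `p`, then `p` lies on the `l`-top face of `conv (Y₀ ∪ Y₁)`; a vertex of that hull is a vertex of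
`conv Y₀` or of `conv Y₁`, and the relative interior of each edge carries at most one such `p` (strictness
pins `X ∩ edge = {p}`; edges ≤ vertices). [folklore] -/
theorem stub_faceCount (X Y₀ Y₁ : Set (Fin 2 → ℝ)) (hX : X.Finite) (hY₀ : Y₀.Finite) (hY₁ : Y₁.Finite)
    (hXY : X ⊆ Y₀ ∪ Y₁) :
    {p : Fin 2 → ℝ | p ∈ Set.extremePoints ℝ (convexHull ℝ X) ∧
        ∃ l : (Fin 2 → ℝ) →ₗ[ℝ] ℝ, (∀ q ∈ X, q ≠ p → l q < l p) ∧ (∀ q ∈ Y₀ ∪ Y₁, l q ≤ l p)}.ncard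
      ≤ 2 * ((Set.extremePoints ℝ (convexHull ℝ Y₀)).ncard
            + (Set.extremePoints ℝ (convexHull ℝ Y₁)).ncard) := by
  -- LANDED (`…FrameRungTwoFaceCount`, `…FrameRungTwoFaceCount.stub_faceCount`, statement unfolded verbatim): by-name citation (stub-credit wiring val-port-1 g1, val-lit RULING #251 (b))
  exact Summit.ValiantsHypothesis.ValiantsHypothesis.Theorems.NewtonFramesTwoProducts.FrameRungTwoFaceCount.stub_faceCount X Y₀ Y₁ hX hY₀ hY₁ hXY
/-- STUB 3 (OPEN — the core of the rung).  CROSS-CANCELLING vertices are few: the vertices `p` of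
`Newt(Σ_i Π_j f i j)` that are strictly exposed by some `l` under which a point of
`supp F₀ ∪ supp F₁` (the two frame-class partial sums) lies STRICTLY ABOVE `p` — i.e. the two classes cancel
above `p` — number `≤ (m t + 2)^{C₂(k)}`.  First target inside: if the demotion cube of the vertex word is
represented CARRY-FREE by the other frame, `DissociatedFixedK.thickness_of_annihilator` gives thickness
`< k` and the floor's count; what is new is the count of CARRYING cubes (two direct systems, de Bruijn /
mixed-radix rigidity).  Cheapest falsifier run: all-ones design `k = 2` (survivors `= S_A Δ S_B`), random +
hill-climb, `m ≤ 7`, `t ≤ 3`: max vertices `2mt + 1`. [ours; setting KPTT arXiv:1308.2286 §2, §5] -/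
theorem stub_crossCancelCount : ∀ k : ℕ, ∃ C : ℕ, ∀ (m t : ℕ) (A : Fin 2 → Fin m → Finset (Fin 2 →₀ ℕ))
    (c : Fin k → Fin 2) (f : Fin k → Fin m → MvPolynomial (Fin 2) ℂ),
    (∀ σ j, (A σ j).card ≤ t) →
    (∀ i j, (f i j).support ⊆ A (c i) j) →
    (∀ σ, ∀ a b : Fin m → (Fin 2 →₀ ℕ), (∀ j, a j ∈ A σ j) → (∀ j, b j ∈ A σ j) →
        ∑ j, a j = ∑ j, b j → a = b) →
    {p : Fin 2 → ℝ | p ∈ Set.extremePoints ℝ (convexHull ℝ (emb ''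
          ((∑ i, ∏ j, f i j).support : Set (Fin 2 →₀ ℕ)))) ∧
        ∃ l : (Fin 2 → ℝ) →ₗ[ℝ] ℝ,
          (∀ q ∈ emb '' ((∑ i, ∏ j, f i j).support : Set (Fin 2 →₀ ℕ)), q ≠ p → l q < l p) ∧
          ∃ q ∈ emb '' ((∑ i ∈ Finset.univ.filter (fun i => c i = 0), ∏ j, f i j).support
                          : Set (Fin 2 →₀ ℕ)) ∪
                 emb '' ((∑ i ∈ Finset.univ.filter (fun i => c i = 1), ∏ j, f i j).support
                          : Set (Fin 2 →₀ ℕ)),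
            l p < l q}.ncard ≤ (m * t + 2) ^ C := by
  sorry

/-! ## Composition (no sorry): the three stubs give the rung BY NAME -/

/-- Splitting a `Fin k`-indexed sum along a `Fin 2`-valued colouring. [folklore] -/
theorem sum_split_fin_two {k : ℕ} {M : Type*} [AddCommMonoid M] (c : Fin k → Fin 2) (g : Fin k → M) :
    ∑ i, g i = (∑ i ∈ Finset.univ.filter (fun i => c i = 0), g i) +
               (∑ i ∈ Finset.univ.filter (fun i => c i = 1), g i) := by
  have key : ∀ x : Fin 2, (¬ x = 0) ↔ x = 1 := by decide
  rw [← Finset.sum_filter_add_sum_filter_not Finset.univ (fun i => c i = 0)]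
  congr 1
  refine Finset.sum_congr ?_ (fun _ _ => rfl)
  ext i
  simp only [Finset.mem_filter, Finset.mem_univ, true_and, key]

/-- Elementary arithmetic for the final count. [folklore] -/
theorem count_arith (x C₁ C₂ : ℕ) (hx : 2 ≤ x) :
    2 * (x ^ C₁ + x ^ C₁) + x ^ C₂ ≤ x ^ (C₁ + C₂ + 3) := by
  have h4 : 4 ≤ x ^ 2 := by nlinarith
  have hx1 : 1 ≤ x := by omega
  calc 2 * (x ^ C₁ + x ^ C₁) + x ^ C₂ = 4 * x ^ C₁ + x ^ C₂ := by ring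
    _ ≤ x ^ 2 * x ^ C₁ + x ^ C₂ := by gcongr
    _ ≤ x ^ (C₁ + C₂ + 2) + x ^ (C₁ + C₂ + 2) := by
        apply Nat.add_le_add
        · rw [← pow_add]; exact Nat.pow_le_pow_right hx1 (by omega)
        · exact Nat.pow_le_pow_right hx1 (by omega)
    _ = 2 * x ^ (C₁ + C₂ + 2) := by ring
    _ ≤ x * x ^ (C₁ + C₂ + 2) := Nat.mul_le_mul_right _ hx
    _ = x ^ (C₁ + C₂ + 3) := by ring

/-- **`FrameRungTwo` from the three stubs** (kernel-checked composition; the only sorries of this file are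
inside `stub_*`).  Every vertex `p` is strictly exposed by some `l` (`exists_strict_exposing_of_finite`);
either no point of `supp F₀ ∪ supp F₁` lies strictly above `p` (cross-free: `stub_faceCount`, fed by
`stub_classHull` on each class) or one does (cross-cancelling: `stub_crossCancelCount`). -/
theorem FrameRungTwo_of
    (h₁ : ∀ k : ℕ, ∃ C : ℕ, ∀ (m t : ℕ) (A : Fin 2 → Fin m → Finset (Fin 2 →₀ ℕ))
      (c : Fin k → Fin 2) (f : Fin k → Fin m → MvPolynomial (Fin 2) ℂ),
      (∀ σ j, (A σ j).card ≤ t) →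
      (∀ i j, (f i j).support ⊆ A (c i) j) →
      (∀ σ, ∀ a b : Fin m → (Fin 2 →₀ ℕ), (∀ j, a j ∈ A σ j) → (∀ j, b j ∈ A σ j) →
          ∑ j, a j = ∑ j, b j → a = b) →
      ∀ σ : Fin 2, (Set.extremePoints ℝ (convexHull ℝ (emb ''
          ((∑ i ∈ Finset.univ.filter (fun i => c i = σ), ∏ j, f i j).support : Set (Fin 2 →₀ ℕ))))).ncard
        ≤ (m * t + 2) ^ C)
    (h₂ : ∀ (X Y₀ Y₁ : Set (Fin 2 → ℝ)), X.Finite → Y₀.Finite → Y₁.Finite → X ⊆ Y₀ ∪ Y₁ →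
      {p : Fin 2 → ℝ | p ∈ Set.extremePoints ℝ (convexHull ℝ X) ∧
          ∃ l : (Fin 2 → ℝ) →ₗ[ℝ] ℝ, (∀ q ∈ X, q ≠ p → l q < l p) ∧ (∀ q ∈ Y₀ ∪ Y₁, l q ≤ l p)}.ncard
        ≤ 2 * ((Set.extremePoints ℝ (convexHull ℝ Y₀)).ncard
              + (Set.extremePoints ℝ (convexHull ℝ Y₁)).ncard))
    (h₃ : ∀ k : ℕ, ∃ C : ℕ, ∀ (m t : ℕ) (A : Fin 2 → Fin m → Finset (Fin 2 →₀ ℕ))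
      (c : Fin k → Fin 2) (f : Fin k → Fin m → MvPolynomial (Fin 2) ℂ),
      (∀ σ j, (A σ j).card ≤ t) →
      (∀ i j, (f i j).support ⊆ A (c i) j) →
      (∀ σ, ∀ a b : Fin m → (Fin 2 →₀ ℕ), (∀ j, a j ∈ A σ j) → (∀ j, b j ∈ A σ j) →
          ∑ j, a j = ∑ j, b j → a = b) →
      {p : Fin 2 → ℝ | p ∈ Set.extremePoints ℝ (convexHull ℝ (emb ''
            ((∑ i, ∏ j, f i j).support : Set (Fin 2 →₀ ℕ)))) ∧
          ∃ l : (Fin 2 → ℝ) →ₗ[ℝ] ℝ,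
            (∀ q ∈ emb '' ((∑ i, ∏ j, f i j).support : Set (Fin 2 →₀ ℕ)), q ≠ p → l q < l p) ∧
            ∃ q ∈ emb '' ((∑ i ∈ Finset.univ.filter (fun i => c i = 0), ∏ j, f i j).support
                            : Set (Fin 2 →₀ ℕ)) ∪
                   emb '' ((∑ i ∈ Finset.univ.filter (fun i => c i = 1), ∏ j, f i j).support
                            : Set (Fin 2 →₀ ℕ)),
              l p < l q}.ncard ≤ (m * t + 2) ^ C) :
    FrameRungTwo := by
  intro k
  obtain ⟨C₁, hC₁⟩ := h₁ k
  obtain ⟨C₂, hC₂⟩ := h₃ k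
  refine ⟨C₁ + C₂ + 3, ?_⟩
  intro m t A c f hA hf hinj
  -- the three specialised facts
  have hcls := hC₁ m t A c f hA hf hinj
  have hcross := hC₂ m t A c f hA hf hinj
  -- names for the supports pushed into the plane
  set F : MvPolynomial (Fin 2) ℂ := ∑ i, ∏ j, f i j with hF
  set F₀ : MvPolynomial (Fin 2) ℂ := ∑ i ∈ Finset.univ.filter (fun i => c i = 0), ∏ j, f i j with hF₀
  set F₁ : MvPolynomial (Fin 2) ℂ := ∑ i ∈ Finset.univ.filter (fun i => c i = 1), ∏ j, f i j with hF₁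
  set X : Set (Fin 2 → ℝ) := emb '' (F.support : Set (Fin 2 →₀ ℕ)) with hX
  set Y₀ : Set (Fin 2 → ℝ) := emb '' (F₀.support : Set (Fin 2 →₀ ℕ)) with hY₀
  set Y₁ : Set (Fin 2 → ℝ) := emb '' (F₁.support : Set (Fin 2 →₀ ℕ)) with hY₁
  have hXfin : X.Finite := F.support.finite_toSet.image emb
  have hY₀fin : Y₀.Finite := F₀.support.finite_toSet.image emb
  have hY₁fin : Y₁.Finite := F₁.support.finite_toSet.image emb
  -- `F = F₀ + F₁`, hence `X ⊆ Y₀ ∪ Y₁`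
  have hsplit : F = F₀ + F₁ := sum_split_fin_two c (fun i => ∏ j, f i j)
  have hXY : X ⊆ Y₀ ∪ Y₁ := by
    intro q hq
    obtain ⟨e, he, rfl⟩ := hq
    have he' : e ∈ (F₀ + F₁).support := by rw [← hsplit]; exact he
    rcases Finset.mem_union.1 (MvPolynomial.support_add he') with h0 | h1
    · exact Or.inl ⟨e, h0, rfl⟩
    · exact Or.inr ⟨e, h1, rfl⟩
  have hface := h₂ X Y₀ Y₁ hXfin hY₀fin hY₁fin hXY
  -- the vertex set and its two parts
  set V : Set (Fin 2 → ℝ) := Set.extremePoints ℝ (convexHull ℝ X) with hV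
  set Pfree : Set (Fin 2 → ℝ) := {p : Fin 2 → ℝ | p ∈ V ∧
      ∃ l : (Fin 2 → ℝ) →ₗ[ℝ] ℝ, (∀ q ∈ X, q ≠ p → l q < l p) ∧ (∀ q ∈ Y₀ ∪ Y₁, l q ≤ l p)} with hPfree
  set Pcross : Set (Fin 2 → ℝ) := {p : Fin 2 → ℝ | p ∈ V ∧
      ∃ l : (Fin 2 → ℝ) →ₗ[ℝ] ℝ, (∀ q ∈ X, q ≠ p → l q < l p) ∧ ∃ q ∈ Y₀ ∪ Y₁, l p < l q} with hPcross
  have hVsub : V ⊆ Pfree ∪ Pcross := by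
    intro p hp
    obtain ⟨l, hl⟩ :=
      Summit.ValiantsHypothesis.ValiantsHypothesis.Theorems.TwoProducts.Negative.exists_strict_exposing_of_finite
        hXfin hp
    by_cases hall : ∀ q ∈ Y₀ ∪ Y₁, l q ≤ l p
    · exact Or.inl ⟨hp, l, hl, hall⟩
    · push Not at hall
      obtain ⟨q, hq, hlt⟩ := hall
      exact Or.inr ⟨hp, l, hl, q, hq, hlt⟩
  have hVfin : V.Finite := hXfin.subset extremePoints_convexHull_subset
  have hPfin : (Pfree ∪ Pcross).Finite :=
    hVfin.subset (Set.union_subset (fun p hp => hp.1) (fun p hp => hp.1))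
  have hx : 2 ≤ m * t + 2 := by omega
  calc V.ncard ≤ (Pfree ∪ Pcross).ncard := Set.ncard_le_ncard hVsub hPfin
    _ ≤ Pfree.ncard + Pcross.ncard := Set.ncard_union_le _ _
    _ ≤ 2 * ((Set.extremePoints ℝ (convexHull ℝ Y₀)).ncard
            + (Set.extremePoints ℝ (convexHull ℝ Y₁)).ncard) + (m * t + 2) ^ C₂ :=
        Nat.add_le_add hface hcross
    _ ≤ 2 * ((m * t + 2) ^ C₁ + (m * t + 2) ^ C₁) + (m * t + 2) ^ C₂ := by
        gcongr
        · exact hcls 0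
        · exact hcls 1
    _ ≤ (m * t + 2) ^ (C₁ + C₂ + 3) := count_arith _ _ _ hx

/-- The composition applied to the stubs (sorries live in the stubs only). -/
theorem frameRungTwo_holds : FrameRungTwo :=
  FrameRungTwo_of stub_classHull stub_faceCount stub_crossCancelCount

/-- Registrar's name for the skeleton's conclusion (`ledger skeleton check --crux-decl …FrameRungTwo`):
the rung BY NAME from the three stubs. -/
theorem FrameRungTwo_proof : FrameRungTwo :=
  FrameRungTwo_of stub_classHull stub_faceCount stub_crossCancelCount

end

end Summit.ValiantsHypothesis.ValiantsHypothesis.Cruxes.TwoProducts.FrameRungTwo
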